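import Literature.MathematicalPhysics.QuantumLattice.LatticeGaugeDLRFreeEnergyProofs
import Literature.MathematicalPhysics.QuantumFieldTheory.WilsonEnergyConvexity
import Literature.Analysis.Convex.PointwiseLimitDerivAt
import HarnessLib

/-!
# `energy_convexOn_freeEnergyDensity`: the torus pressure is convex in `β`

Helper of the energy programme of crux `FibreToTorus` (stmt-QuantumFields-16244), line
`Sketch`, route `ContractibleFibre`.  For a continuous matrix representation `ρ` of a compact
second-countable group `G` and every `d`, the free energy density
`freeEnergyDensity d ρ : ℝ → ℝ`, `β ↦ lim_L (L+1)^{-d} log Z_{Λ_{L+1}, β}`, is convex on `ℝ`.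

Proof (folklore; Friedli–Velenik 2017, Ch. 3, Thm. 3.6 / Lemma 6.89 pattern): for each torus
size the finite-volume pressure `β ↦ log Z_{Λ_{L+1}, β}` is convex
(`convexOn_torusLogPartition` of `WilsonEnergyConvexity`), hence so is its non-negative
multiple `(L+1)^{-d} log Z_{Λ_{L+1}, β}` (`ConvexOn.smul`); the free energy density is the
pointwise limit of these (`exists_hasFreeEnergyDensity_holds`,
`hasFreeEnergyDensity_freeEnergyDensity`), and a pointwise limit of convex functions on `ℝ` is
convex (`Literature.Analysis.Convex.convexOn_univ_of_tendsto`).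
-/

noncomputable section

open MeasureTheory Filter Topology Finset
open Literature.MathematicalPhysics.QuantumLattice (LGConfig ZdEdge freeEnergyDensity torusLogPartition HasFreeEnergyDensity
  hasFreeEnergyDensity_freeEnergyDensity exists_hasFreeEnergyDensity_holds)

namespace Summit.QuantumFields.YangMills.Theorems.FibreToTorus

/-- **Convexity of the torus pressure.** For a continuous matrix representation `ρ` of a
compact second-countable group, `β ↦ freeEnergyDensity d ρ β` is convex on `ℝ`: it is the
pointwise limit of the convex finite-volume pressures `(L+1)^{-d} log Z_{Λ_{L+1}, β}`
(Friedli–Velenik 2017, Thm. 3.6 / Lemma 6.89 pattern). [folklore] -/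
theorem energy_convexOn_freeEnergyDensity : ∀ (d N : ℕ) (G : Type) [Group G] [TopologicalSpace G] [IsTopologicalGroup G] [CompactSpace G] [MeasurableSpace G] [BorelSpace G] [SecondCountableTopology G] (ρ : G →* Matrix (Fin N) (Fin N) ℂ), Continuous ρ → ConvexOn ℝ Set.univ (freeEnergyDensity d ρ) := by
  intro d N G _ _ _ _ _ _ _ ρ hρ
  -- the finite-volume pressures `g L β := (L+1)^{-d} log Z_{Λ_{L+1}, β}`
  refine Literature.Analysis.Convex.convexOn_univ_of_tendsto
    (f := fun L β => (((L + 1 : ℕ) : ℝ) ^ d)⁻¹ * torusLogPartition d ρ β (L + 1))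
    (fun L => ?_) (fun β => ?_)
  · -- each `g L` is a non-negative multiple of the convex `β ↦ log Z_{Λ_{L+1}, β}`
    have hc := Literature.MathematicalPhysics.QuantumFieldTheory.convexOn_torusLogPartition
      (d := d) (L := L + 1) ρ hρ
    have hnn : (0 : ℝ) ≤ (((L + 1 : ℕ) : ℝ) ^ d)⁻¹ := by positivity
    simpa [smul_eq_mul] using hc.smul hnn
  · -- pointwise convergence to the free energy density (existence of the pressure)
    exact hasFreeEnergyDensity_freeEnergyDensity ρ
      ⟨_, (exists_hasFreeEnergyDensity_holds (d := d) ρ hρ β).choose_spec⟩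

end Summit.QuantumFields.YangMills.Theorems.FibreToTorus

end
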